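import Mathlib
import Summits.CriticalPhenomena.CardyFormulaZ2.Theorems.CardySelfRefinementRussoDriftTangency

/-!
# Forced tangency, II: the tangential speed vanishes a.e.; the drift tends to zero

Support file for item `RussoDrift` (stmt-CriticalPhenomena-10271) of route `CardySelfRefinement`
(sub-problem `CriticalPhenomena/CardyFormulaZ2`); continuation of
`CardySelfRefinementRussoDriftTangency` (moving-frame FTC estimate `abs_sub_sub_integral_le`,
sign-definite weights `le_abs_integral_of_sign_definite`).  See that file for the setting
(Lipschitz path `γ`, measurable unit field `u`, `C¹` family `Φ η` with `Φ η ∘ γ ∈ [0,1]`, gradient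
hypotheses (T) tangency up to `ε(η) → 0`, (C) comparability, (D) uniform divergence, (S) constant
sign of the tangential component).

* `ae_nonpos_of_forced_tangency` — the tangential speed `u · γ'` is `≤ 0` a.e. on `(0, L)`: at a
  Lebesgue point `t₀` of `(u·γ')^±` with `u·γ' (t₀) > 0` (`LocallyIntegrable.ae_hasDerivAt_integral`),
  on a short interval `[t₀, b]` the weight `λ = g·u` has constant sign and values in `[m, 2Λ² m]`, so
  `|∫ λ (u·γ')| ≥ m (u·γ')(t₀) (b − t₀)/4`, while `|∫ λ (u·γ')| ≤ 1 + 2L` because `Φ ∘ γ ∈ [0,1]`;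
  this bounds `m ≍` the gradient size, contradicting (D).
* `tendsto_sub_of_forced_tangency` — hence (`u` and `−u`) `u · γ' = 0` a.e., and the drift
  `Φ η (γ L) − Φ η (γ 0)` is at most `2 ε(η) L → 0`.

Pure real analysis (Mathlib only).
-/

noncomputable section

open Set Filter Topology MeasureTheory intervalIntegral

namespace Summit.CriticalPhenomena.CardyFormulaZ2.Theorems.RussoDrift

/-- **The tangential speed is a.e. non-positive** (hence, by symmetry `u ↦ −u`, a.e. zero).  Under
the forced-tangency hypotheses (T) (gradient `ε(η)`-parallel to the unit field `u`, `ε → 0`),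
(C) (comparability of the gradient size along the path), (D) (uniform divergence), (S) (constant
sign of the tangential component) and `Φ η ∘ γ ∈ [0,1]`, the component `u · γ'` of the velocity of
the Lipschitz path along `u` is `≤ 0` for a.e. `t ∈ (0, L)`.  (Lebesgue differentiation at a point
where `u·γ' > 0`, then `le_abs_integral_of_sign_definite` against `abs_sub_sub_integral_le`.) -/
theorem ae_nonpos_of_forced_tangency {L η₀ : ℝ} (hη₀ : 0 < η₀)
    {γ : ℝ → ℝ × ℝ} (hγ₁ : LipschitzWith 1 fun t => (γ t).1) (hγ₂ : LipschitzWith 1 fun t => (γ t).2)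
    {u : ℝ → ℝ × ℝ} (hum : Measurable u) (hu : ∀ t, (u t).1 ^ 2 + (u t).2 ^ 2 = 1)
    {Φ : ℝ → ℝ × ℝ → ℝ} (hΦ : ∀ η ∈ Ioo 0 η₀, ContDiff ℝ 1 (Φ η))
    (hΦ01 : ∀ η ∈ Ioo 0 η₀, ∀ t, Φ η (γ t) ∈ Icc (0 : ℝ) 1)
    {g₁ g₂ : ℝ → ℝ → ℝ}
    (hg₁ : ∀ η ∈ Ioo 0 η₀, ∀ t, g₁ η t = fderiv ℝ (Φ η) (γ t) (1, 0))
    (hg₂ : ∀ η ∈ Ioo 0 η₀, ∀ t, g₂ η t = fderiv ℝ (Φ η) (γ t) (0, 1))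
    {ε : ℝ → ℝ} (hε : Tendsto ε (𝓝[>] 0) (𝓝 0))
    (hT : ∀ η ∈ Ioo 0 η₀, ∀ t, |(u t).2 * g₁ η t - (u t).1 * g₂ η t| ≤ ε η)
    {Λ : ℝ} (hC : ∀ η ∈ Ioo 0 η₀, ∀ t t', |g₁ η t| + |g₂ η t| ≤ Λ * (|g₁ η t'| + |g₂ η t'|))
    (hD : ∀ N : ℝ, ∃ η₁ > 0, ∀ η ∈ Ioo 0 η₁, ∀ t, N ≤ |g₁ η t| + |g₂ η t|)
    (hS : ∀ η ∈ Ioo 0 η₀, (∀ t, 0 < (u t).1 * g₁ η t + (u t).2 * g₂ η t) ∨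
      (∀ t, (u t).1 * g₁ η t + (u t).2 * g₂ η t < 0)) :
    ∀ᵐ t, t ∈ Ioo 0 L → (u t).1 * (deriv γ t).1 + (u t).2 * (deriv γ t).2 ≤ 0 := by
  have hγ : LipschitzWith 1 γ := by simpa using hγ₁.prodMk hγ₂
  have hγc : Continuous γ := hγ.continuous
  have hv : ∀ t, ‖deriv γ t‖ ≤ 1 := fun t => by
    simpa using norm_deriv_le_of_lipschitz (x₀ := t) hγ
  have hv₁ : ∀ t, |(deriv γ t).1| ≤ 1 := fun t =>
    (Real.norm_eq_abs _ ▸ norm_fst_le (deriv γ t)).trans (hv t)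
  have hv₂ : ∀ t, |(deriv γ t).2| ≤ 1 := fun t =>
    (Real.norm_eq_abs _ ▸ norm_snd_le (deriv γ t)).trans (hv t)
  have hu₁ : ∀ t, |(u t).1| ≤ 1 := fun t =>
    (sq_le_one_iff_abs_le_one _).1 (by nlinarith [sq_nonneg (u t).2, hu t])
  have hu₂ : ∀ t, |(u t).2| ≤ 1 := fun t =>
    (sq_le_one_iff_abs_le_one _).1 (by nlinarith [sq_nonneg (u t).1, hu t])
  have hvm : Measurable (deriv γ) := measurable_deriv γ
  have hu₁m : Measurable fun t => (u t).1 := measurable_fst.comp hum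
  have hu₂m : Measurable fun t => (u t).2 := measurable_snd.comp hum
  -- the tangential speed and its positive / negative parts
  set w : ℝ → ℝ := fun t => (u t).1 * (deriv γ t).1 + (u t).2 * (deriv γ t).2 with hw
  have hw_m : Measurable w :=
    (hu₁m.mul (measurable_fst.comp hvm)).add (hu₂m.mul (measurable_snd.comp hvm))
  have hw_b : ∀ t, |w t| ≤ 2 := by
    intro t
    simp only [hw]
    calc |(u t).1 * (deriv γ t).1 + (u t).2 * (deriv γ t).2|
        ≤ |(u t).1 * (deriv γ t).1| + |(u t).2 * (deriv γ t).2| := abs_add_le _ _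
      _ = |(u t).1| * |(deriv γ t).1| + |(u t).2| * |(deriv γ t).2| := by rw [abs_mul, abs_mul]
      _ ≤ 1 * 1 + 1 * 1 :=
          add_le_add (mul_le_mul (hu₁ t) (hv₁ t) (abs_nonneg _) zero_le_one)
            (mul_le_mul (hu₂ t) (hv₂ t) (abs_nonneg _) zero_le_one)
      _ = 2 := by norm_num
  have hwp_m : Measurable fun t => max (w t) 0 := hw_m.max measurable_const
  have hwm_m : Measurable fun t => max (-w t) 0 := hw_m.neg.max measurable_const
  have hloc : ∀ f : ℝ → ℝ, Measurable f → (∀ t, |f t| ≤ 2) → LocallyIntegrable f volume :=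
    fun f hf hfb => (locallyIntegrable_const (2 : ℝ)).mono hf.aestronglyMeasurable
      (Eventually.of_forall fun t => by
        rw [Real.norm_eq_abs, Real.norm_eq_abs, abs_two]; exact hfb t)
  have hwp_b : ∀ t, |max (w t) 0| ≤ 2 := fun t => by
    rw [abs_of_nonneg (le_max_right _ _)]
    exact max_le ((le_abs_self _).trans (hw_b t)) ((abs_nonneg _).trans (hw_b t))
  have hwm_b : ∀ t, |max (-w t) 0| ≤ 2 := fun t => by
    rw [abs_of_nonneg (le_max_right _ _)]
    exact max_le ((neg_le_abs _).trans (hw_b t)) ((abs_nonneg _).trans (hw_b t))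
  have hLp := _root_.LocallyIntegrable.ae_hasDerivAt_integral (hloc _ hwp_m hwp_b)
  have hLm := _root_.LocallyIntegrable.ae_hasDerivAt_integral (hloc _ hwm_m hwm_b)
  -- suppose not: pick a Lebesgue point `t₀ ∈ (0, L)` with `w t₀ > 0`
  by_contra hcon
  obtain ⟨t₀, ⟨hp, hm⟩, hbad⟩ := ((hLp.and hLm).and_frequently (not_eventually.1 hcon)).exists
  obtain ⟨ht₀, hwt₀⟩ := Classical.not_imp.1 hbad
  have ha : 0 < w t₀ := not_le.1 hwt₀
  set a := w t₀ with ha_def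
  have hL : 0 < L := ht₀.1.trans ht₀.2
  -- `1 ≤ Λ`
  have hΛ : 1 ≤ Λ := by
    obtain ⟨η₁, hη₁, h1⟩ := hD 1
    have hη : min η₀ η₁ / 2 ∈ Ioo 0 η₀ ∧ min η₀ η₁ / 2 ∈ Ioo 0 η₁ := by
      refine ⟨⟨by positivity, ?_⟩, ⟨by positivity, ?_⟩⟩
      · linarith [min_le_left η₀ η₁]
      · linarith [min_le_right η₀ η₁]
    have hG := h1 _ hη.2 0
    have hcomp := hC _ hη.1 0 0
    nlinarith
  set R : ℝ := 2 * Λ ^ 2 with hR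
  have hR0 : 0 < R := by positivity
  set δ : ℝ := a / (4 * R) with hδ
  have hδ0 : 0 < δ := by positivity
  -- a short interval `[t₀, b] ⊆ (0, L)` on which `w⁺` is large and `w⁻` is small on average
  have e1 : ∀ᶠ x in 𝓝[>] t₀, a / 2 * (x - t₀) ≤ ∫ t in t₀..x, max (w t) 0 := by
    have hd := hp t₀
    have hwp₀ : max (w t₀) 0 = a := max_eq_left ha.le
    rw [hwp₀, hasDerivAt_iff_tendsto_slope] at hd
    have h2 : Tendsto (slope (fun x => ∫ t in t₀..x, max (w t) 0) t₀) (𝓝[>] t₀) (𝓝 a) :=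
      hd.mono_left (nhdsWithin_mono _ fun x hx => ne_of_gt hx)
    have h3 := h2.eventually (lt_mem_nhds (by linarith : a / 2 < a))
    filter_upwards [h3, self_mem_nhdsWithin] with x hx hx'
    rw [slope_def_field] at hx
    simp only [integral_same, sub_zero] at hx
    have hxt : 0 < x - t₀ := sub_pos.2 hx'
    rw [lt_div_iff₀ hxt] at hx
    linarith
  have e2 : ∀ᶠ x in 𝓝[>] t₀, ∫ t in t₀..x, max (-w t) 0 ≤ δ * (x - t₀) := by
    have hd := hm t₀
    have hwm₀ : max (-w t₀) 0 = 0 := max_eq_right (by linarith)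
    rw [hwm₀, hasDerivAt_iff_tendsto_slope] at hd
    have h2 : Tendsto (slope (fun x => ∫ t in t₀..x, max (-w t) 0) t₀) (𝓝[>] t₀) (𝓝 0) :=
      hd.mono_left (nhdsWithin_mono _ fun x hx => ne_of_gt hx)
    have h3 := h2.eventually (gt_mem_nhds hδ0)
    filter_upwards [h3, self_mem_nhdsWithin] with x hx hx'
    rw [slope_def_field] at hx
    simp only [integral_same, sub_zero] at hx
    have hxt : 0 < x - t₀ := sub_pos.2 hx'
    rw [div_lt_iff₀ hxt] at hx
    linarith
  obtain ⟨b, hb1, hb2, hb3⟩ := (e1.and (e2.and (Ioo_mem_nhdsGT ht₀.2))).exists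
  have hb0 : t₀ < b := hb3.1
  have hbL : b < L := hb3.2
  have hrl : 0 < b - t₀ := sub_pos.2 hb0
  -- small `η`: `ε η < 1` and the gradient exceeds the critical size `N`
  obtain ⟨η₂, hη₂, hε2⟩ := (nhdsGT_basis (0 : ℝ)).eventually_iff.1 (hε.eventually (gt_mem_nhds one_pos))
  set N : ℝ := 8 * Λ * (1 + 2 * L) / ((b - t₀) * a) + 2 * Λ + 1 with hN
  obtain ⟨η₁, hη₁, hN1⟩ := hD N
  set η : ℝ := min η₀ (min η₁ η₂) / 2 with hη_def
  have hηpos : 0 < η := by positivity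
  have hη0 : η ∈ Ioo 0 η₀ := ⟨hηpos, by
    have := min_le_left η₀ (min η₁ η₂); rw [hη_def]; linarith⟩
  have hη1 : η ∈ Ioo 0 η₁ := ⟨hηpos, by
    have := (min_le_right η₀ (min η₁ η₂)).trans (min_le_left η₁ η₂); rw [hη_def]; linarith⟩
  have hη2 : η ∈ Ioo 0 η₂ := ⟨hηpos, by
    have := (min_le_right η₀ (min η₁ η₂)).trans (min_le_right η₁ η₂); rw [hη_def]; linarith⟩
  have hε1 : ε η < 1 := hε2 hη2
  have hε0 : 0 ≤ ε η := (abs_nonneg _).trans (hT η hη0 0)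
  -- the gradient at mesh `η`: size `G`, tangential component `lam`
  set G : ℝ → ℝ := fun t => |g₁ η t| + |g₂ η t| with hG
  set lam : ℝ → ℝ := fun t => (u t).1 * g₁ η t + (u t).2 * g₂ η t with hlam
  have hG0 : N ≤ G t₀ := hN1 η hη1 t₀
  have hNΛ : 2 * Λ ≤ N := by
    have : 0 ≤ 8 * Λ * (1 + 2 * L) / ((b - t₀) * a) := by positivity
    rw [hN]; linarith
  have hGup : ∀ t, G t ≤ Λ * G t₀ := fun t => hC η hη0 t t₀
  have hGlow : ∀ t, G t₀ ≤ Λ * G t := fun t => hC η hη0 t₀ t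
  have hlam_up : ∀ t, |lam t| ≤ G t := by
    intro t
    simp only [hlam, hG]
    calc |(u t).1 * g₁ η t + (u t).2 * g₂ η t| ≤ |(u t).1 * g₁ η t| + |(u t).2 * g₂ η t| :=
          abs_add_le _ _
      _ = |(u t).1| * |g₁ η t| + |(u t).2| * |g₂ η t| := by rw [abs_mul, abs_mul]
      _ ≤ 1 * |g₁ η t| + 1 * |g₂ η t| :=
          add_le_add (mul_le_mul_of_nonneg_right (hu₁ t) (abs_nonneg _))
            (mul_le_mul_of_nonneg_right (hu₂ t) (abs_nonneg _))
      _ = |g₁ η t| + |g₂ η t| := by ring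
  set mlow : ℝ := G t₀ / (2 * Λ) with hmlow
  have hΛ0 : 0 < Λ := by linarith
  have hGpos : 0 < G t₀ := by linarith
  have hmlow0 : 0 < mlow := by positivity
  have hlam_low : ∀ t, mlow ≤ |lam t| := by
    intro t
    have hGt : 2 ≤ G t := by
      refine le_of_mul_le_mul_left ?_ hΛ0
      linarith [hGlow t]
    -- Lagrange identity: lam² + (u₂ g₁ − u₁ g₂)² = g₁² + g₂²
    have hlag : lam t ^ 2 + ((u t).2 * g₁ η t - (u t).1 * g₂ η t) ^ 2 =
        g₁ η t ^ 2 + g₂ η t ^ 2 := by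
      simp only [hlam]
      linear_combination (g₁ η t ^ 2 + g₂ η t ^ 2) * hu t
    have hperp : ((u t).2 * g₁ η t - (u t).1 * g₂ η t) ^ 2 ≤ 1 := by
      have h := hT η hη0 t
      have h' : |(u t).2 * g₁ η t - (u t).1 * g₂ η t| ≤ 1 := h.trans hε1.le
      exact (sq_le_one_iff_abs_le_one _).2 h'
    have hsq : G t ^ 2 ≤ 2 * (g₁ η t ^ 2 + g₂ η t ^ 2) := by
      simp only [hG]
      nlinarith [sq_nonneg (|g₁ η t| - |g₂ η t|), sq_abs (g₁ η t), sq_abs (g₂ η t)]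
    have hX4 : (2 : ℝ) ^ 2 ≤ G t ^ 2 := pow_le_pow_left₀ zero_le_two hGt 2
    have h4 : (G t / 2) ^ 2 ≤ lam t ^ 2 := by
      rw [show (G t / 2) ^ 2 = G t ^ 2 / 4 by ring]
      linarith [hlag, hperp, hsq, hX4]
    have h5 : G t / 2 ≤ |lam t| := by
      have h6 := sq_le_sq.1 h4
      rwa [abs_of_nonneg (by linarith : (0 : ℝ) ≤ G t / 2)] at h6
    calc mlow = G t₀ / (2 * Λ) := rfl
      _ ≤ Λ * G t / (2 * Λ) := div_le_div_of_nonneg_right (hGlow t) (by positivity)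
      _ = G t / 2 := by rw [mul_comm Λ (G t), mul_div_mul_right _ _ hΛ0.ne']
      _ ≤ |lam t| := h5
  -- the sign-definite sandwich `mlow ≤ ±lam ≤ R mlow`
  have hRm : R * mlow = Λ * G t₀ := by
    rw [hR, hmlow]
    field_simp
  have hsd : (∀ t, mlow ≤ lam t ∧ lam t ≤ R * mlow) ∨ (∀ t, mlow ≤ -lam t ∧ -lam t ≤ R * mlow) := by
    rcases hS η hη0 with hpos | hneg
    · refine Or.inl fun t => ?_
      have hl : 0 < lam t := hpos t
      have h1 := hlam_low t
      have h2 := hlam_up t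
      rw [abs_of_pos hl] at h1 h2
      exact ⟨h1, by rw [hRm]; exact h2.trans (hGup t)⟩
    · refine Or.inr fun t => ?_
      have hl : lam t < 0 := hneg t
      have h1 := hlam_low t
      have h2 := hlam_up t
      rw [abs_of_neg hl] at h1 h2
      exact ⟨h1, by rw [hRm]; exact h2.trans (hGup t)⟩
  have hg₁c : Continuous (g₁ η) := continuous_of_eq_fderiv (hΦ η hη0) hγc (1, 0) (hg₁ η hη0)
  have hg₂c : Continuous (g₂ η) := continuous_of_eq_fderiv (hΦ η hη0) hγc (0, 1) (hg₂ η hη0)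
  have hlam_m : Measurable lam := (hu₁m.mul hg₁c.measurable).add (hu₂m.mul hg₂c.measurable)
  -- lower bound for `|∫ lam w|` on `[t₀, b]` …
  have hlow := le_abs_integral_of_sign_definite hlam_m hw_m hw_b hb0.le hmlow0.le hR0.le hsd hb1 hb2
  -- … and upper bound from the FTC estimate and `Φ ∘ γ ∈ [0,1]`
  have hup : |Φ η (γ b) - Φ η (γ t₀) - ∫ t in t₀..b, lam t * w t| ≤ 2 * ε η * (b - t₀) :=
    abs_sub_sub_integral_le hγ₁ hγ₂ (hΦ η hη0) hum hu (hg₁ η hη0) (hg₂ η hη0) (hT η hη0) hb0.le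
  have hI1 : |∫ t in t₀..b, lam t * w t| ≤ 1 + 2 * L := by
    have h01b := hΦ01 η hη0 b
    have h01t := hΦ01 η hη0 t₀
    have hdiff : |Φ η (γ b) - Φ η (γ t₀)| ≤ 1 := by
      rw [abs_le]
      constructor <;> linarith [h01b.1, h01b.2, h01t.1, h01t.2]
    have hεL : ε η * (b - t₀) ≤ 1 * L :=
      mul_le_mul hε1.le (by linarith [ht₀.1]) hrl.le zero_le_one
    have htri := abs_sub_abs_le_abs_sub (∫ t in t₀..b, lam t * w t) (Φ η (γ b) - Φ η (γ t₀))
    rw [abs_sub_comm (∫ t in t₀..b, lam t * w t) (Φ η (γ b) - Φ η (γ t₀))] at htri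
    linarith
  have hRδ : R * δ = a / 4 := by
    rw [hδ]
    field_simp
  have hrew : mlow * (a / 2 * (b - t₀)) - R * mlow * (δ * (b - t₀)) = mlow * (b - t₀) * a / 4 := by
    rw [show R * mlow * (δ * (b - t₀)) = mlow * (b - t₀) * (R * δ) by ring, hRδ]
    ring
  have hfinal : mlow * (b - t₀) * a / 4 ≤ 1 + 2 * L := by linarith
  have hkey : G t₀ * ((b - t₀) * a) ≤ 8 * Λ * (1 + 2 * L) := by
    have h8 : mlow * (b - t₀) * a / 4 = G t₀ * ((b - t₀) * a) / (8 * Λ) := by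
      rw [hmlow]
      field_simp
      ring
    rw [h8, div_le_iff₀ (by positivity)] at hfinal
    linarith
  have hle : G t₀ ≤ 8 * Λ * (1 + 2 * L) / ((b - t₀) * a) := by
    rw [le_div_iff₀ (by positivity)]
    exact hkey
  have hlt : 8 * Λ * (1 + 2 * L) / ((b - t₀) * a) < N := by rw [hN]; linarith
  exact absurd hG0 (not_le.2 (hle.trans_lt hlt))

/-- **Forced tangency ⇒ vanishing drift.**  Along a path with `1`-Lipschitz coordinates, a family
`Φ η ∈ C¹(ℝ²)` with `Φ η ∘ γ ∈ [0,1]`, whose gradient along the path is `ε(η)`-parallel to a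
measurable unit field `u` with `ε → 0` (T), comparable in size between path points (C), uniformly
divergent (D) and with tangential component of constant sign (S), has drift
`Φ η (γ L) − Φ η (γ 0) → 0` as `η → 0⁺`: the tangential speed `u·γ'` vanishes a.e.
(`ae_nonpos_of_forced_tangency` for `u` and `−u`), and the normal component of the gradient
contributes at most `2 ε(η) L` (`abs_sub_sub_integral_le`). -/
theorem tendsto_sub_of_forced_tangency {L η₀ : ℝ} (hL : 0 ≤ L) (hη₀ : 0 < η₀)
    {γ : ℝ → ℝ × ℝ} (hγ₁ : LipschitzWith 1 fun t => (γ t).1) (hγ₂ : LipschitzWith 1 fun t => (γ t).2)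
    {u : ℝ → ℝ × ℝ} (hum : Measurable u) (hu : ∀ t, (u t).1 ^ 2 + (u t).2 ^ 2 = 1)
    {Φ : ℝ → ℝ × ℝ → ℝ} (hΦ : ∀ η ∈ Ioo 0 η₀, ContDiff ℝ 1 (Φ η))
    (hΦ01 : ∀ η ∈ Ioo 0 η₀, ∀ t, Φ η (γ t) ∈ Icc (0 : ℝ) 1)
    {g₁ g₂ : ℝ → ℝ → ℝ}
    (hg₁ : ∀ η ∈ Ioo 0 η₀, ∀ t, g₁ η t = fderiv ℝ (Φ η) (γ t) (1, 0))
    (hg₂ : ∀ η ∈ Ioo 0 η₀, ∀ t, g₂ η t = fderiv ℝ (Φ η) (γ t) (0, 1))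
    {ε : ℝ → ℝ} (hε : Tendsto ε (𝓝[>] 0) (𝓝 0))
    (hT : ∀ η ∈ Ioo 0 η₀, ∀ t, |(u t).2 * g₁ η t - (u t).1 * g₂ η t| ≤ ε η)
    {Λ : ℝ} (hC : ∀ η ∈ Ioo 0 η₀, ∀ t t', |g₁ η t| + |g₂ η t| ≤ Λ * (|g₁ η t'| + |g₂ η t'|))
    (hD : ∀ N : ℝ, ∃ η₁ > 0, ∀ η ∈ Ioo 0 η₁, ∀ t, N ≤ |g₁ η t| + |g₂ η t|)
    (hS : ∀ η ∈ Ioo 0 η₀, (∀ t, 0 < (u t).1 * g₁ η t + (u t).2 * g₂ η t) ∨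
      (∀ t, (u t).1 * g₁ η t + (u t).2 * g₂ η t < 0)) :
    Tendsto (fun η => Φ η (γ L) - Φ η (γ 0)) (𝓝[>] 0) (𝓝 0) := by
  have h1 := ae_nonpos_of_forced_tangency (L := L) hη₀ hγ₁ hγ₂ hum hu hΦ hΦ01 hg₁ hg₂ hε hT hC hD hS
  have hu' : ∀ t, (-u t).1 ^ 2 + (-u t).2 ^ 2 = 1 := fun t => by simpa using hu t
  have hT' : ∀ η ∈ Ioo 0 η₀, ∀ t, |(-u t).2 * g₁ η t - (-u t).1 * g₂ η t| ≤ ε η := by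
    intro η hη t
    have h := hT η hη t
    have e : (-u t).2 * g₁ η t - (-u t).1 * g₂ η t = -((u t).2 * g₁ η t - (u t).1 * g₂ η t) := by
      simp only [Prod.snd_neg, Prod.fst_neg]
      ring
    rw [e, abs_neg]
    exact h
  have hS' : ∀ η ∈ Ioo 0 η₀, (∀ t, 0 < (-u t).1 * g₁ η t + (-u t).2 * g₂ η t) ∨
      (∀ t, (-u t).1 * g₁ η t + (-u t).2 * g₂ η t < 0) := by
    intro η hη
    rcases hS η hη with h | h
    · refine Or.inr fun t => ?_
      have := h t
      simp only [Prod.fst_neg, Prod.snd_neg, neg_mul]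
      linarith
    · refine Or.inl fun t => ?_
      have := h t
      simp only [Prod.fst_neg, Prod.snd_neg, neg_mul]
      linarith
  have h2 := ae_nonpos_of_forced_tangency (L := L) hη₀ hγ₁ hγ₂ hum.neg hu' hΦ hΦ01 hg₁ hg₂ hε hT'
    hC hD hS'
  have hw0 : ∀ᵐ t, t ∈ Ioo 0 L → (u t).1 * (deriv γ t).1 + (u t).2 * (deriv γ t).2 = 0 := by
    filter_upwards [h1, h2] with t ht1 ht2 ht
    have e1 := ht1 ht
    have e2 := ht2 ht
    simp only [Pi.neg_apply, Prod.fst_neg, Prod.snd_neg, neg_mul] at e2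
    linarith
  have hL' : ∀ᵐ t : ℝ, t ≠ L := by simp [ae_iff, measure_singleton]
  have hbound : ∀ η ∈ Ioo 0 η₀, |Φ η (γ L) - Φ η (γ 0)| ≤ 2 * ε η * L := by
    intro η hη
    have hup := abs_sub_sub_integral_le hγ₁ hγ₂ (hΦ η hη) hum hu (hg₁ η hη) (hg₂ η hη) (hT η hη) hL
    have hint : ∫ t in (0 : ℝ)..L, ((u t).1 * g₁ η t + (u t).2 * g₂ η t) *
        ((u t).1 * (deriv γ t).1 + (u t).2 * (deriv γ t).2) = 0 := by
      have hae : ∀ᵐ t : ℝ, t ∈ uIoc (0 : ℝ) L → ((u t).1 * g₁ η t + (u t).2 * g₂ η t) *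
          ((u t).1 * (deriv γ t).1 + (u t).2 * (deriv γ t).2) = (fun _ => (0 : ℝ)) t := by
        filter_upwards [hw0, hL'] with t ht htL hmem
        rw [uIoc_of_le hL] at hmem
        have htI : t ∈ Ioo 0 L := ⟨hmem.1, lt_of_le_of_ne hmem.2 htL⟩
        rw [ht htI, mul_zero]
      rw [integral_congr_ae hae, intervalIntegral.integral_zero]
    rw [hint, sub_zero, sub_zero] at hup
    exact hup
  have hev : ∀ᶠ η in 𝓝[>] 0, ‖Φ η (γ L) - Φ η (γ 0)‖ ≤ 2 * L * |ε η| := by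
    filter_upwards [Ioo_mem_nhdsGT hη₀] with η hη
    rw [Real.norm_eq_abs]
    calc |Φ η (γ L) - Φ η (γ 0)| ≤ 2 * ε η * L := hbound η hη
      _ = 2 * L * ε η := by ring
      _ ≤ 2 * L * |ε η| := mul_le_mul_of_nonneg_left (le_abs_self _) (by positivity)
  have hlim : Tendsto (fun η => 2 * L * |ε η|) (𝓝[>] 0) (𝓝 0) := by
    simpa using (hε.abs.const_mul (2 * L))
  exact squeeze_zero_norm' hev hlim

end Summit.CriticalPhenomena.CardyFormulaZ2.Theorems.RussoDrift

end
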